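import Literature.Computability.Cryptography.ChenQuantumLWEWindowBound
import Literature.Computability.Cryptography.ChenQuantumLWEWindowShift
import Mathlib.Algebra.Order.Chebyshev

/-!
# Every window weight on Chen's chirped line: Abel summation and the `(2 + log P)·V/√P`-type ceiling (T8 for general windows)

REPRODUCTION / ANALYSIS OF A CLAIMED RESULT UNDER ADJUDICATION (withdrawn): Yilei Chen, *Quantum
Algorithms for Lattice Problems*, IACR ePrint 2024/555, version of 2024-04-18 [ChenQuantumLattice2024]
(the version carrying the author's note that Step 9 contains a bug), Step 9 (§3.5.9, pp. 34–38) acting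
on `|φ8.b⟩ = Σ_{j ∈ ℤ_P} e(-j²/P) |2D²j·b + v′ mod N⟩` (p. 35), `P = p₁Q`, `N = D²P`.  Bundle
`papers/QuantumAdvantage/lwe-quantum-autopsy/`, Part 2 (`REPAIR-CENSUS.md` §1 theorem **T8**, §10 and
§11), sequel of `ChenQuantumLWEWindowBound.lean` (interval INDICATOR windows: `Pr ≤ (2 + log P)/√P`) and
`ChenQuantumLWEWindowShift.lean` (a window at relative position `j₀` gives the `j₀ = 0` law translated
by `j₀`).
HONEST FRAMING: kernel-checked THEOREMS about states occurring in a WITHDRAWN algorithm — a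
quantitative NEGATIVE result for the "smooth the chirp with a (discrete Gaussian, raised-cosine, …)
window instead of cancelling it" repairs, NOT summit progress, no cryptanalytic claim in either
direction, no new algorithm; quantum lower bounds are out of scope.

## What is proved

A general WINDOW WEIGHT `w : ℤ_P → ℂ` supported on an interval `{A+1, …, A+W}` of `W ≤ P` line
positions (the best case, in which the window's position in the LINE coordinate is granted), giving the
line profile `chirpWeight w = ψ_P(−j²)·w(j)`:

* `sum_Ioc_mul_eq_abel`, `norm_sum_Ioc_mul_le` — ABEL SUMMATION on an integer interval and Abel's
  inequality: if all initial partial sums of `Φ` over `{A+1,…,A+k}`, `k ≤ W`, have norm `≤ B`, then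
  `‖Σ_{A<m≤A+W} Φ(m)g(m)‖ ≤ B·(‖g(A+W)‖ + Σ_{1≤k<W} ‖g(A+k+1) − g(A+k)‖)`.
* `norm_chirpWeight_sum_le`: with `ChenQuantumLWEWindowBound.norm_incGauss_interval_le` (every initial
  segment of the shifted chirp has `|Σ| ≤ √P(2 + log P)`, completion of sums) this gives
  `|Σ_j ψ_P(−(j+t)²) w(j)| ≤ √P·(2 + log P)·V(w)` for EVERY shift `t`, where
  `V(w) = intervalVariation w A W = |w(A+W)| + Σ_{1≤k<W} |w(A+k+1) − w(A+k)|` (last value plus interior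
  total variation; `= 1` for the indicator, and `intervalVariation_le_of_unimodal`: `≤ 2·max w` for
  every unimodal non-negative weight — truncated discrete Gaussian, raised cosine, trapezoid).
* `norm_sq_profileDFT_le_card_mul`, **`prob_profile_le_card`** — the SUPPORT BOUND for an ARBITRARY
  profile `c` supported on a set `S`: `|ĉ(s)|² ≤ |S|·‖c‖²` (Cauchy–Schwarz), hence
  `Pr[⟨b, u mod P⟩ = t] ≤ |S|/P` (referee note N-7.3 of the bundle: previously in Lean only for
  indicator windows, `prob_windowedChirp_le`).
* **`prob_chirpWeight_le`**: `Pr[t] ≤ (2 + log P)²·V(w)²/‖w‖₂²`; **`prob_chirpWeight_le_sqrt`**: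
  `Pr[t] ≤ ((2 + log P)/√P)·(V(w)·√W/‖w‖₂)` for every value `t`, every `b` with `b₀ = −1`, every
  offset — the interval-indicator ceiling `(2 + log P)/√P` of `ChenQuantumLWEWindowBound` times the
  FLATNESS RATIO `V(w)√W/‖w‖₂` of the weight (`= 1` for the indicator; `O((log P)^{1/4})` for a
  discrete Gaussian truncated at `±σ√(log P)`, any `σ` — `REPAIR-CENSUS.md` §11).
* `prob_chirpWeight_shift_le`: the same bound for the window applied at ANY relative position `j₀` to
  the chirp (the unknown centre only translates the law, `ChenQuantumLWEWindowShift`).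
* `Shape.prob_chirpWeight_le_sqrt`, `Shape.prob_profile_le_card`: the same for every admissible shape.

## What is NOT here

Windows supported on several intervals (apply `norm_sum_Ioc_mul_le` per interval); the `log` is not
optimised; a lower bound (a window of width `≍ √P` at the stationary point does reach `Pr ≍ 1/√P`,
Lehmer 1976 — so the `√P` scale is right); nothing about how a modified Steps 1–8 would produce a given
weight, and nothing about the unknown centre beyond `prob_chirpWeight_shift_le`.
-/

namespace Literature.Computability.Cryptography.Chen2024

open scoped BigOperators

/-! ### Abel summation on an integer interval -/

section Abel

open Finset

/-- **Abel summation** on the integer interval `{A+1, …, A+W}` with partial sums taken from the left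
end: `Σ Φ·g = F(W)·g(A+W) − Σ_{k<W} F(k)·(g(A+k+1) − g(A+k))`, `F(k) = Σ_{A<m≤A+k} Φ(m)`. [folklore] -/
theorem sum_Ioc_mul_eq_abel (Φ g : ℕ → ℂ) (A W : ℕ) :
    ∑ m ∈ Ioc A (A + W), Φ m * g m
      = (∑ m ∈ Ioc A (A + W), Φ m) * g (A + W)
        - ∑ k ∈ range W, (∑ m ∈ Ioc A (A + k), Φ m) * (g (A + k + 1) - g (A + k)) := by
  induction W with
  | zero => simp
  | succ W ih =>
      rw [← add_assoc, sum_Ioc_succ_top (by omega : A ≤ A + W),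
        sum_Ioc_succ_top (by omega : A ≤ A + W), sum_range_succ, ih]
      ring

/-- **Abel's inequality**: if every initial partial sum `F(k)`, `k ≤ W`, has norm `≤ B`, then
`‖Σ_{A<m≤A+W} Φ(m)g(m)‖ ≤ B·(‖g(A+W)‖ + Σ_{1≤k<W} ‖g(A+k+1) − g(A+k)‖)`. [folklore] -/
theorem norm_sum_Ioc_mul_le (Φ g : ℕ → ℂ) (A W : ℕ) {B : ℝ}
    (hB : ∀ k ≤ W, ‖∑ m ∈ Ioc A (A + k), Φ m‖ ≤ B) :
    ‖∑ m ∈ Ioc A (A + W), Φ m * g m‖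
      ≤ B * (‖g (A + W)‖ + ∑ k ∈ Ico 1 W, ‖g (A + k + 1) - g (A + k)‖) := by
  rw [sum_Ioc_mul_eq_abel]
  have hIco : ∑ k ∈ Ico 1 W, ‖(∑ m ∈ Ioc A (A + k), Φ m) * (g (A + k + 1) - g (A + k))‖
      = ∑ k ∈ range W, ‖(∑ m ∈ Ioc A (A + k), Φ m) * (g (A + k + 1) - g (A + k))‖ := by
    refine sum_subset (fun k hk => ?_) (fun k hk hk' => ?_)
    · rw [mem_Ico] at hk
      exact mem_range.2 hk.2
    · have h0 : k = 0 := by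
        rw [mem_range] at hk
        rw [mem_Ico] at hk'
        omega
      subst h0
      simp
  have h1 : ‖(∑ m ∈ Ioc A (A + W), Φ m) * g (A + W)‖ ≤ B * ‖g (A + W)‖ := by
    rw [norm_mul]
    exact mul_le_mul_of_nonneg_right (hB W le_rfl) (norm_nonneg _)
  have h2 : ‖∑ k ∈ range W, (∑ m ∈ Ioc A (A + k), Φ m) * (g (A + k + 1) - g (A + k))‖
      ≤ B * ∑ k ∈ Ico 1 W, ‖g (A + k + 1) - g (A + k)‖ := by
    calc ‖∑ k ∈ range W, (∑ m ∈ Ioc A (A + k), Φ m) * (g (A + k + 1) - g (A + k))‖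
        ≤ ∑ k ∈ range W, ‖(∑ m ∈ Ioc A (A + k), Φ m) * (g (A + k + 1) - g (A + k))‖ :=
          norm_sum_le _ _
      _ = ∑ k ∈ Ico 1 W, ‖(∑ m ∈ Ioc A (A + k), Φ m) * (g (A + k + 1) - g (A + k))‖ := hIco.symm
      _ ≤ ∑ k ∈ Ico 1 W, B * ‖g (A + k + 1) - g (A + k)‖ := by
          refine sum_le_sum fun k hk => ?_
          rw [norm_mul]
          rw [mem_Ico] at hk
          exact mul_le_mul_of_nonneg_right (hB k (by omega)) (norm_nonneg _)
      _ = B * ∑ k ∈ Ico 1 W, ‖g (A + k + 1) - g (A + k)‖ := by rw [mul_sum]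
  calc ‖(∑ m ∈ Ioc A (A + W), Φ m) * g (A + W)
          - ∑ k ∈ range W, (∑ m ∈ Ioc A (A + k), Φ m) * (g (A + k + 1) - g (A + k))‖
      ≤ ‖(∑ m ∈ Ioc A (A + W), Φ m) * g (A + W)‖
          + ‖∑ k ∈ range W, (∑ m ∈ Ioc A (A + k), Φ m) * (g (A + k + 1) - g (A + k))‖ :=
        norm_sub_le _ _
    _ ≤ B * ‖g (A + W)‖ + B * ∑ k ∈ Ico 1 W, ‖g (A + k + 1) - g (A + k)‖ := add_le_add h1 h2
    _ = B * (‖g (A + W)‖ + ∑ k ∈ Ico 1 W, ‖g (A + k + 1) - g (A + k)‖) := by ring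

end Abel

/-! ### A weight on an interval of line positions, and its chirped profile -/

section Weight

variable (p₁ Q : ℕ+)

/-- The VARIATION of a window weight along the interval `{A+1, …, A+W}` of line positions: the last
value plus the interior total variation, `V(w) = |w(A+W)| + Σ_{1≤k<W} |w(A+k+1) − w(A+k)|`
(`= 1` for the indicator of the interval; `≤ 2·max w` for a unimodal non-negative weight). [folklore] -/
noncomputable def intervalVariation (w : ZP p₁ Q → ℂ) (A W : ℕ) : ℝ :=
  ‖w ((A + W : ℕ) : ZP p₁ Q)‖
    + ∑ k ∈ Finset.Ico 1 W, ‖w ((A + k + 1 : ℕ) : ZP p₁ Q) - w ((A + k : ℕ) : ZP p₁ Q)‖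

/-- The variation is non-negative. [folklore] -/
theorem intervalVariation_nonneg (w : ZP p₁ Q → ℂ) (A W : ℕ) : 0 ≤ intervalVariation p₁ Q w A W :=
  add_nonneg (norm_nonneg _) (Finset.sum_nonneg fun _ _ => norm_nonneg _)

/-- Telescoping over an integer interval. [folklore] -/
theorem sum_Ico_succ_sub_eq (r : ℕ → ℝ) {a b : ℕ} (hab : a ≤ b) :
    ∑ k ∈ Finset.Ico a b, (r (k + 1) - r k) = r b - r a := by
  induction b, hab using Nat.le_induction with
  | base => simp
  | succ b hab ih => rw [Finset.sum_Ico_succ_top hab, ih]; ring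

/-- The variation of a UNIMODAL non-negative real sequence on `{1, …, W}` (non-decreasing up to a mode
`M`, non-increasing after it) is at most twice its maximum: `r(W) + Σ_{1≤k<W} |r(k+1) − r(k)| ≤ 2·r(M)`.
[folklore] -/
theorem unimodal_variation_le (r : ℕ → ℝ) (W M : ℕ) (h1M : 1 ≤ M) (hMW : M ≤ W)
    (hr0 : ∀ k, 0 ≤ r k) (hup : ∀ k, 1 ≤ k → k < M → r k ≤ r (k + 1))
    (hdown : ∀ k, M ≤ k → k < W → r (k + 1) ≤ r k) :
    r W + ∑ k ∈ Finset.Ico 1 W, |r (k + 1) - r k| ≤ 2 * r M := by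
  have hsplit : ∑ k ∈ Finset.Ico 1 W, |r (k + 1) - r k|
      = ∑ k ∈ Finset.Ico 1 M, (r (k + 1) - r k) + ∑ k ∈ Finset.Ico M W, (r k - r (k + 1)) := by
    rw [← Finset.sum_Ico_consecutive _ h1M hMW]
    congr 1
    · refine Finset.sum_congr rfl fun k hk => ?_
      rw [Finset.mem_Ico] at hk
      exact abs_of_nonneg (by linarith [hup k hk.1 hk.2])
    · refine Finset.sum_congr rfl fun k hk => ?_
      rw [Finset.mem_Ico] at hk
      rw [abs_sub_comm]
      exact abs_of_nonneg (by linarith [hdown k hk.1 hk.2])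
  have hneg : ∑ k ∈ Finset.Ico M W, (r k - r (k + 1)) = -(∑ k ∈ Finset.Ico M W, (r (k + 1) - r k)) := by
    rw [← Finset.sum_neg_distrib]
    exact Finset.sum_congr rfl fun k _ => by ring
  rw [hsplit, hneg, sum_Ico_succ_sub_eq r h1M, sum_Ico_succ_sub_eq r hMW]
  linarith [hr0 1]

/-- For a weight whose values on the interval `{A+1, …, A+W}` form a unimodal non-negative real
sequence `r` with mode at `A+M`, `V(w) ≤ 2·r(M)` (e.g. a truncated discrete Gaussian, a raised cosine,
a trapezoid). [folklore] -/
theorem intervalVariation_le_of_unimodal (w : ZP p₁ Q → ℂ) (A W M : ℕ) (h1M : 1 ≤ M) (hMW : M ≤ W)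
    (r : ℕ → ℝ) (hr : ∀ k, 1 ≤ k → k ≤ W → w ((A + k : ℕ) : ZP p₁ Q) = (r k : ℂ))
    (hr0 : ∀ k, 0 ≤ r k) (hup : ∀ k, 1 ≤ k → k < M → r k ≤ r (k + 1))
    (hdown : ∀ k, M ≤ k → k < W → r (k + 1) ≤ r k) :
    intervalVariation p₁ Q w A W ≤ 2 * r M := by
  have hW : w ((A + W : ℕ) : ZP p₁ Q) = (r W : ℂ) := hr W (h1M.trans hMW) le_rfl
  have hV : intervalVariation p₁ Q w A W = r W + ∑ k ∈ Finset.Ico 1 W, |r (k + 1) - r k| := by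
    unfold intervalVariation
    rw [hW, Complex.norm_real, Real.norm_eq_abs, abs_of_nonneg (hr0 W)]
    congr 1
    refine Finset.sum_congr rfl fun k hk => ?_
    rw [Finset.mem_Ico] at hk
    have h1 : w ((A + k + 1 : ℕ) : ZP p₁ Q) = (r (k + 1) : ℂ) := by
      rw [add_assoc]; exact hr (k + 1) (by omega) (by omega)
    rw [h1, hr k hk.1 (le_of_lt hk.2), ← Complex.ofReal_sub, Complex.norm_real, Real.norm_eq_abs]
  rw [hV]
  exact unimodal_variation_le r W M h1M hMW hr0 hup hdown

/-- The CHIRP WEIGHTED BY `w`: the line profile `ψ_P(−j²)·w(j)` (Chen's chirp seen through a window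
weight — an indicator, a discrete Gaussian, the Kraus weight of a partial measurement of the line
coordinate). [cite: ChenQuantumLattice2024, §3.5.9 p. 35 (the chirped line); folklore] -/
noncomputable def chirpWeight (w : ZP p₁ Q → ℂ) : ZP p₁ Q → ℂ :=
  fun j => (ZMod.stdAddChar (-(j ^ 2)) : ℂ) * w j

/-- `‖chirpWeight w‖₂² = ‖w‖₂²`. [folklore] -/
theorem sum_norm_sq_chirpWeight (w : ZP p₁ Q → ℂ) :
    ∑ j, ‖chirpWeight p₁ Q w j‖ ^ 2 = ∑ j, ‖w j‖ ^ 2 := by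
  refine Finset.sum_congr rfl fun j _ => ?_
  rw [chirpWeight, norm_mul, ZMod.stdAddChar_apply, Circle.norm_coe, one_mul]

/-- `chirpWeight w` vanishes where `w` does. [folklore] -/
theorem chirpWeight_eq_zero {w : ZP p₁ Q → ℂ} {j : ZP p₁ Q} (h : w j = 0) :
    chirpWeight p₁ Q w j = 0 := by
  rw [chirpWeight, h, mul_zero]

/-- The spectrum of the weighted chirp at `−2t` is the weighted incomplete Gauss sum:
`ĉ(−2t) = ψ_P(t²)·Σ_j ψ_P(−(j+t)²) w(j)` (completing the square). [cite: Korobov1992, Ch. I §3] -/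
theorem profileDFT_chirpWeight (w : ZP p₁ Q → ℂ) (t : ZP p₁ Q) :
    profileDFT p₁ Q (chirpWeight p₁ Q w) (-(2 * t))
      = ZMod.stdAddChar (t ^ 2) * ∑ j, (ZMod.stdAddChar (-((j + t) ^ 2)) : ℂ) * w j := by
  unfold profileDFT chirpWeight
  rw [Finset.mul_sum]
  refine Finset.sum_congr rfl fun j _ => ?_
  have h : (ZMod.stdAddChar (-(j ^ 2)) : ℂ) * (ZMod.stdAddChar (j * -(2 * t)) : ℂ)
      = ZMod.stdAddChar (t ^ 2) * (ZMod.stdAddChar (-((j + t) ^ 2)) : ℂ) := by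
    rw [← AddChar.map_add_eq_mul, ← AddChar.map_add_eq_mul]
    congr 1
    ring
  calc (ZMod.stdAddChar (-(j ^ 2)) : ℂ) * w j * ZMod.stdAddChar (j * -(2 * t))
      = (ZMod.stdAddChar (-(j ^ 2)) : ℂ) * (ZMod.stdAddChar (j * -(2 * t)) : ℂ) * w j := by ring
    _ = ZMod.stdAddChar (t ^ 2) * (ZMod.stdAddChar (-((j + t) ^ 2)) : ℂ) * w j := by rw [h]
    _ = ZMod.stdAddChar (t ^ 2) * ((ZMod.stdAddChar (-((j + t) ^ 2)) : ℂ) * w j) := by ring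

/-- Every spectral value is a weighted incomplete Gauss sum up to a phase (odd `P`: `s = −2t` with
`t = −2⁻¹s`). [cite: Korobov1992, Ch. I §3] -/
theorem norm_profileDFT_chirpWeight (hP : Odd ((p₁ * Q : ℕ+) : ℕ)) (w : ZP p₁ Q → ℂ) (s : ZP p₁ Q) :
    ∃ t : ZP p₁ Q, ‖profileDFT p₁ Q (chirpWeight p₁ Q w) s‖
      = ‖∑ j, (ZMod.stdAddChar (-((j + t) ^ 2)) : ℂ) * w j‖ := by
  obtain ⟨u, hu⟩ := Literature.NumberTheory.GaussSums.isUnit_two_zmod_of_odd _ hP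
  refine ⟨-(((u⁻¹ : (ZP p₁ Q)ˣ) : ZP p₁ Q) * s), ?_⟩
  have hs : -(2 * -(((u⁻¹ : (ZP p₁ Q)ˣ) : ZP p₁ Q) * s)) = s := by
    rw [← hu, mul_neg, neg_neg, ← mul_assoc, Units.mul_inv, one_mul]
  conv_lhs => rw [← hs]
  rw [profileDFT_chirpWeight, norm_mul, ZMod.stdAddChar_apply, Circle.norm_coe, one_mul]

/-- For a weight supported in the interval window (`W ≤ P`), a sum against `w` over `ℤ_P` is a sum
over the integers `A+1, …, A+W`. [folklore] -/
theorem sum_mul_eq_sum_Ioc (A W : ℕ) (hW : W ≤ ((p₁ * Q : ℕ+) : ℕ)) (w : ZP p₁ Q → ℂ)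
    (hw : ∀ j, j ∉ intervalWindow p₁ Q A W → w j = 0) (f : ZP p₁ Q → ℂ) :
    ∑ j, f j * w j = ∑ m ∈ Finset.Ioc A (A + W), f (m : ZP p₁ Q) * w (m : ZP p₁ Q) := by
  rw [← Finset.sum_subset (Finset.subset_univ (intervalWindow p₁ Q A W))
        (fun j _ hj => by rw [hw j hj, mul_zero]),
    intervalWindow, Finset.sum_image (natCast_injOn_Ioc p₁ Q A W hW)]

/-- **The weighted incomplete Gauss sum** (Abel summation × completion of sums): for odd `P ≥ 2`, a
weight `w` supported on an interval window of width `W ≤ P` and EVERY shift `t`,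
`|Σ_j ψ_P(−(j+t)²) w(j)| ≤ √P·(2 + log P)·V(w)`. [cite: Korobov1992, Ch. I §2 Thm 2 and §3 Thm 3; Bordelles2020ArithmeticTales, Thm 6.13] -/
theorem norm_chirpWeight_sum_le (hP : Odd ((p₁ * Q : ℕ+) : ℕ)) (h2 : 2 ≤ ((p₁ * Q : ℕ+) : ℕ))
    (A W : ℕ) (hW : W ≤ ((p₁ * Q : ℕ+) : ℕ)) (w : ZP p₁ Q → ℂ)
    (hw : ∀ j, j ∉ intervalWindow p₁ Q A W → w j = 0) (t : ZP p₁ Q) :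
    ‖∑ j, (ZMod.stdAddChar (-((j + t) ^ 2)) : ℂ) * w j‖
      ≤ Real.sqrt ((p₁ * Q : ℕ+) : ℕ) * (2 + Real.log ((p₁ * Q : ℕ+) : ℕ))
        * intervalVariation p₁ Q w A W := by
  rw [sum_mul_eq_sum_Ioc p₁ Q A W hW w hw]
  have hB : ∀ k ≤ W,
      ‖∑ m ∈ Finset.Ioc A (A + k), (ZMod.stdAddChar (-(((m : ℕ) : ZP p₁ Q) + t) ^ 2) : ℂ)‖
        ≤ Real.sqrt ((p₁ * Q : ℕ+) : ℕ) * (2 + Real.log ((p₁ * Q : ℕ+) : ℕ)) := by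
    intro k hk
    rw [← incGauss_intervalWindow p₁ Q A k (hk.trans hW) t]
    exact norm_incGauss_interval_le p₁ Q hP h2 A k (hk.trans hW) t
  unfold intervalVariation
  exact norm_sum_Ioc_mul_le (fun m => (ZMod.stdAddChar (-(((m : ℕ) : ZP p₁ Q) + t) ^ 2) : ℂ))
    (fun m => w (m : ZP p₁ Q)) A W hB

/-- **Support bound for an arbitrary profile** (Cauchy–Schwarz): if `c` vanishes off `S` then
`|ĉ(s)|² ≤ |S|·‖c‖₂²` for every `s`. [folklore] -/
theorem norm_sq_profileDFT_le_card_mul (c : ZP p₁ Q → ℂ) (S : Finset (ZP p₁ Q))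
    (hc : ∀ j, j ∉ S → c j = 0) (s : ZP p₁ Q) :
    ‖profileDFT p₁ Q c s‖ ^ 2 ≤ (S.card : ℝ) * ∑ j, ‖c j‖ ^ 2 := by
  have h1 : profileDFT p₁ Q c s = ∑ j ∈ S, c j * (ZMod.stdAddChar (j * s) : ℂ) := by
    unfold profileDFT
    exact (Finset.sum_subset (Finset.subset_univ S) (fun j _ hj => by rw [hc j hj, zero_mul])).symm
  have h2 : ‖profileDFT p₁ Q c s‖ ≤ ∑ j ∈ S, ‖c j‖ := by
    rw [h1]
    calc ‖∑ j ∈ S, c j * (ZMod.stdAddChar (j * s) : ℂ)‖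
        ≤ ∑ j ∈ S, ‖c j * (ZMod.stdAddChar (j * s) : ℂ)‖ := norm_sum_le _ _
      _ = ∑ j ∈ S, ‖c j‖ := Finset.sum_congr rfl fun j _ => by
          rw [norm_mul, ZMod.stdAddChar_apply, Circle.norm_coe, mul_one]
  have h3 : ∑ j ∈ S, ‖c j‖ ^ 2 ≤ ∑ j, ‖c j‖ ^ 2 :=
    Finset.sum_le_sum_of_subset_of_nonneg (Finset.subset_univ S) fun j _ _ => by positivity
  calc ‖profileDFT p₁ Q c s‖ ^ 2 ≤ (∑ j ∈ S, ‖c j‖) ^ 2 := by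
        gcongr
    _ ≤ (S.card : ℝ) * ∑ j ∈ S, ‖c j‖ ^ 2 := sq_sum_le_card_mul_sum_sq
    _ ≤ (S.card : ℝ) * ∑ j, ‖c j‖ ^ 2 := by gcongr

end Weight

/-! ### The probability law of the hyperplane value for a weighted chirp -/

section Line

variable (n : ℕ) (D p₁ Q : ℕ+) (b v' : Fin (n + 1) → ℤ)

/-- **Support bound, probability form** (referee note N-7.3 of the bundle): for ANY non-zero profile
`c` vanishing off a set `S` of line positions, every hyperplane value has probability `≤ |S|/P`
(odd `P`, `b₀ = −1`). [cite: ChenQuantumLattice2024, §3.5.9 pp. 35–38; folklore] -/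
theorem prob_profile_le_card (hP : Odd ((p₁ * Q : ℕ+) : ℕ)) (hb : b 0 = -1) (c : ZP p₁ Q → ℂ)
    (hc0 : ∑ j, ‖c j‖ ^ 2 ≠ 0) (S : Finset (ZP p₁ Q)) (hc : ∀ j, j ∉ S → c j = 0) (t : ZP p₁ Q) :
    (∑ u ∈ Finset.univ.filter (fun u : Fin (n + 1) → ZN D p₁ Q => lineFun n D p₁ Q b u = t),
        weight (qft (profileKet n D p₁ Q b v' c)) u)
        / ∑ u, weight (qft (profileKet n D p₁ Q b v' c)) u
      ≤ (S.card : ℝ) / (((p₁ * Q : ℕ+) : ℕ) : ℝ) := by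
  rw [prob_lineFun_eq n D p₁ Q b v' hP hb c hc0 t]
  have hP0 : (0 : ℝ) < (((p₁ * Q : ℕ+) : ℕ) : ℝ) := by exact_mod_cast PNat.pos _
  have hc0' : 0 < ∑ j, ‖c j‖ ^ 2 :=
    lt_of_le_of_ne (Finset.sum_nonneg fun j _ => by positivity) (Ne.symm hc0)
  calc ‖profileDFT p₁ Q c (-(2 * t))‖ ^ 2 / ((((p₁ * Q : ℕ+) : ℕ) : ℝ) * ∑ j, ‖c j‖ ^ 2)
      ≤ ((S.card : ℝ) * ∑ j, ‖c j‖ ^ 2) / ((((p₁ * Q : ℕ+) : ℕ) : ℝ) * ∑ j, ‖c j‖ ^ 2) := by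
        gcongr
        exact norm_sq_profileDFT_le_card_mul p₁ Q c S hc _
    _ = (S.card : ℝ) / (((p₁ * Q : ℕ+) : ℕ) : ℝ) := by
        rw [mul_div_mul_right _ _ (ne_of_gt hc0')]

/-- **General window weight, first bound**: for odd `P ≥ 2`, `b₀ = −1`, a weight `w ≠ 0` supported on an
interval window of width `W ≤ P` and EVERY hyperplane value `t`:
`Pr[⟨b, u mod P⟩ = t] ≤ (2 + log P)²·V(w)²/‖w‖₂²`. [cite: Korobov1992, Ch. I §2 Thm 2 and §3 Thm 3; ChenQuantumLattice2024, §3.5.9 pp. 35–38] -/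
theorem prob_chirpWeight_le (hP : Odd ((p₁ * Q : ℕ+) : ℕ)) (h2 : 2 ≤ ((p₁ * Q : ℕ+) : ℕ))
    (hb : b 0 = -1) (A W : ℕ) (hW : W ≤ ((p₁ * Q : ℕ+) : ℕ)) (w : ZP p₁ Q → ℂ)
    (hw : ∀ j, j ∉ intervalWindow p₁ Q A W → w j = 0) (hw0 : ∑ j, ‖w j‖ ^ 2 ≠ 0) (t : ZP p₁ Q) :
    (∑ u ∈ Finset.univ.filter (fun u : Fin (n + 1) → ZN D p₁ Q => lineFun n D p₁ Q b u = t),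
        weight (qft (profileKet n D p₁ Q b v' (chirpWeight p₁ Q w))) u)
        / ∑ u, weight (qft (profileKet n D p₁ Q b v' (chirpWeight p₁ Q w))) u
      ≤ (2 + Real.log ((p₁ * Q : ℕ+) : ℕ)) ^ 2 * intervalVariation p₁ Q w A W ^ 2
          / ∑ j, ‖w j‖ ^ 2 := by
  have hc : ∑ j, ‖chirpWeight p₁ Q w j‖ ^ 2 ≠ 0 := by rwa [sum_norm_sq_chirpWeight]
  rw [prob_lineFun_eq n D p₁ Q b v' hP hb _ hc t, sum_norm_sq_chirpWeight, profileDFT_chirpWeight,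
    norm_mul, ZMod.stdAddChar_apply, Circle.norm_coe, one_mul]
  have hP0 : (0 : ℝ) < (((p₁ * Q : ℕ+) : ℕ) : ℝ) := by exact_mod_cast PNat.pos _
  have hw0' : 0 < ∑ j, ‖w j‖ ^ 2 :=
    lt_of_le_of_ne (Finset.sum_nonneg fun j _ => by positivity) (Ne.symm hw0)
  have hG := norm_chirpWeight_sum_le p₁ Q hP h2 A W hW w hw t
  calc ‖∑ j, (ZMod.stdAddChar (-((j + t) ^ 2)) : ℂ) * w j‖ ^ 2
          / ((((p₁ * Q : ℕ+) : ℕ) : ℝ) * ∑ j, ‖w j‖ ^ 2)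
      ≤ (Real.sqrt ((p₁ * Q : ℕ+) : ℕ) * (2 + Real.log ((p₁ * Q : ℕ+) : ℕ))
            * intervalVariation p₁ Q w A W) ^ 2
          / ((((p₁ * Q : ℕ+) : ℕ) : ℝ) * ∑ j, ‖w j‖ ^ 2) := by
        gcongr
    _ = (2 + Real.log ((p₁ * Q : ℕ+) : ℕ)) ^ 2 * intervalVariation p₁ Q w A W ^ 2
          / ∑ j, ‖w j‖ ^ 2 := by
        rw [mul_pow, mul_pow, Real.sq_sqrt hP0.le, mul_assoc,
          mul_div_mul_left _ _ (ne_of_gt hP0)]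

/-- The support bound for a weighted chirp on an interval window: `Pr[t] ≤ W/P`. [folklore] -/
theorem prob_chirpWeight_le_width (hP : Odd ((p₁ * Q : ℕ+) : ℕ)) (hb : b 0 = -1) (A W : ℕ)
    (hW : W ≤ ((p₁ * Q : ℕ+) : ℕ)) (w : ZP p₁ Q → ℂ)
    (hw : ∀ j, j ∉ intervalWindow p₁ Q A W → w j = 0) (hw0 : ∑ j, ‖w j‖ ^ 2 ≠ 0) (t : ZP p₁ Q) :
    (∑ u ∈ Finset.univ.filter (fun u : Fin (n + 1) → ZN D p₁ Q => lineFun n D p₁ Q b u = t),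
        weight (qft (profileKet n D p₁ Q b v' (chirpWeight p₁ Q w))) u)
        / ∑ u, weight (qft (profileKet n D p₁ Q b v' (chirpWeight p₁ Q w))) u
      ≤ (W : ℝ) / (((p₁ * Q : ℕ+) : ℕ) : ℝ) := by
  have hc : ∑ j, ‖chirpWeight p₁ Q w j‖ ^ 2 ≠ 0 := by rwa [sum_norm_sq_chirpWeight]
  have h := prob_profile_le_card n D p₁ Q b v' hP hb (chirpWeight p₁ Q w) hc (intervalWindow p₁ Q A W)
    (fun j hj => chirpWeight_eq_zero p₁ Q (hw j hj)) t
  rwa [card_intervalWindow p₁ Q A W hW] at h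

/-- **T8 for every window weight** — for odd `P ≥ 2`, `b₀ = −1`, EVERY weight `w ≠ 0` supported on an
interval window of width `W ≤ P`, EVERY hyperplane value `t` and every offset `v′`:
`Pr[⟨b, u mod P⟩ = t] ≤ ((2 + log P)/√P)·(V(w)·√W/‖w‖₂)` — the interval-indicator ceiling times the
flatness ratio of the weight. [cite: Korobov1992, Ch. I §2 Thm 2 and §3 Thm 3; ChenQuantumLattice2024, §3.5.9 pp. 35–38, §3.7.1 p. 60] -/
theorem prob_chirpWeight_le_sqrt (hP : Odd ((p₁ * Q : ℕ+) : ℕ)) (h2 : 2 ≤ ((p₁ * Q : ℕ+) : ℕ))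
    (hb : b 0 = -1) (A W : ℕ) (hW : W ≤ ((p₁ * Q : ℕ+) : ℕ)) (w : ZP p₁ Q → ℂ)
    (hw : ∀ j, j ∉ intervalWindow p₁ Q A W → w j = 0) (hw0 : ∑ j, ‖w j‖ ^ 2 ≠ 0) (t : ZP p₁ Q) :
    (∑ u ∈ Finset.univ.filter (fun u : Fin (n + 1) → ZN D p₁ Q => lineFun n D p₁ Q b u = t),
        weight (qft (profileKet n D p₁ Q b v' (chirpWeight p₁ Q w))) u)
        / ∑ u, weight (qft (profileKet n D p₁ Q b v' (chirpWeight p₁ Q w))) u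
      ≤ (2 + Real.log ((p₁ * Q : ℕ+) : ℕ)) / Real.sqrt ((p₁ * Q : ℕ+) : ℕ)
          * (intervalVariation p₁ Q w A W * Real.sqrt W / Real.sqrt (∑ j, ‖w j‖ ^ 2)) := by
  have hP0 : (0 : ℝ) < (((p₁ * Q : ℕ+) : ℕ) : ℝ) := by exact_mod_cast PNat.pos _
  have hw0' : 0 < ∑ j, ‖w j‖ ^ 2 :=
    lt_of_le_of_ne (Finset.sum_nonneg fun j _ => by positivity) (Ne.symm hw0)
  have hL : 0 ≤ 2 + Real.log ((p₁ * Q : ℕ+) : ℕ) := by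
    have : 0 ≤ Real.log ((p₁ * Q : ℕ+) : ℕ) :=
      Real.log_nonneg (by exact_mod_cast (le_trans (by norm_num) h2 : 1 ≤ ((p₁ * Q : ℕ+) : ℕ)))
    linarith
  have hV := intervalVariation_nonneg p₁ Q w A W
  have hA := prob_chirpWeight_le_width n D p₁ Q b v' hP hb A W hW w hw hw0 t
  have hB := prob_chirpWeight_le n D p₁ Q b v' hP h2 hb A W hW w hw hw0 t
  have h0 : 0 ≤ (∑ u ∈ Finset.univ.filter (fun u : Fin (n + 1) → ZN D p₁ Q => lineFun n D p₁ Q b u = t),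
        weight (qft (profileKet n D p₁ Q b v' (chirpWeight p₁ Q w))) u)
        / ∑ u, weight (qft (profileKet n D p₁ Q b v' (chirpWeight p₁ Q w))) u :=
    div_nonneg (Finset.sum_nonneg fun u _ => by unfold weight; positivity)
      (Finset.sum_nonneg fun u _ => by unfold weight; positivity)
  -- two upper bounds of a non-negative quantity combine to their geometric mean
  -- (`Literature.MathematicalPhysics.QuantumLattice.le_sqrt_mul_of_le_of_le`, not imported here)
  have key : ∀ {x a c : ℝ}, 0 ≤ x → x ≤ a → x ≤ c → x ≤ Real.sqrt (a * c) := fun hx ha hc =>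
    (Real.sqrt_sq hx).symm.le.trans
      (Real.sqrt_le_sqrt (by rw [sq]; exact mul_le_mul ha hc hx (hx.trans ha)))
  refine (key h0 hA hB).trans (le_of_eq ?_)
  rw [show (W : ℝ) / (((p₁ * Q : ℕ+) : ℕ) : ℝ)
      * ((2 + Real.log ((p₁ * Q : ℕ+) : ℕ)) ^ 2 * intervalVariation p₁ Q w A W ^ 2 / ∑ j, ‖w j‖ ^ 2)
      = ((2 + Real.log ((p₁ * Q : ℕ+) : ℕ)) / Real.sqrt ((p₁ * Q : ℕ+) : ℕ)
          * (intervalVariation p₁ Q w A W * Real.sqrt W / Real.sqrt (∑ j, ‖w j‖ ^ 2))) ^ 2 by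
      rw [mul_pow, div_pow, div_pow, mul_pow, Real.sq_sqrt hP0.le, Real.sq_sqrt hw0'.le,
        Real.sq_sqrt (Nat.cast_nonneg W)]
      field_simp]
  exact Real.sqrt_sq (mul_nonneg (div_nonneg hL (Real.sqrt_nonneg _))
    (div_nonneg (mul_nonneg hV (Real.sqrt_nonneg _)) (Real.sqrt_nonneg _)))

/-- **The window at an unknown relative position obeys the same bound.** For the weight applied at ANY
relative position `j₀` to the chirp (`ChenQuantumLWEWindowShift`: the law is the `j₀ = 0` law
translated by `j₀`), every hyperplane value has probability `≤ (2 + log P)²·V(w)²/‖w‖₂²`.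
[cite: Korobov1992, Ch. I §2 Thm 2 and §3 Thm 3; ChenQuantumLattice2024, §3.5.9 pp. 35–38] -/
theorem prob_chirpWeight_shift_le (hP : Odd ((p₁ * Q : ℕ+) : ℕ)) (h2 : 2 ≤ ((p₁ * Q : ℕ+) : ℕ))
    (hb : b 0 = -1) (A W : ℕ) (hW : W ≤ ((p₁ * Q : ℕ+) : ℕ)) (w : ZP p₁ Q → ℂ)
    (hw : ∀ j, j ∉ intervalWindow p₁ Q A W → w j = 0) (hw0 : ∑ j, ‖w j‖ ^ 2 ≠ 0) (j₀ t : ZP p₁ Q) :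
    (∑ u ∈ Finset.univ.filter (fun u : Fin (n + 1) → ZN D p₁ Q => lineFun n D p₁ Q b u = t),
        weight (qft (profileKet n D p₁ Q b v'
          (fun j => (ZMod.stdAddChar (-(j ^ 2)) : ℂ) * w (j - j₀)))) u)
        / ∑ u, weight (qft (profileKet n D p₁ Q b v'
          (fun j => (ZMod.stdAddChar (-(j ^ 2)) : ℂ) * w (j - j₀)))) u
      ≤ (2 + Real.log ((p₁ * Q : ℕ+) : ℕ)) ^ 2 * intervalVariation p₁ Q w A W ^ 2
          / ∑ j, ‖w j‖ ^ 2 := by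
  rw [prob_chirpWindow_shift n D p₁ Q b v' hP hb w hw0 j₀ t,
    show (fun j => (ZMod.stdAddChar (-(j ^ 2)) : ℂ) * w j) = chirpWeight p₁ Q w from rfl,
    profileDFT_chirpWeight, norm_mul, ZMod.stdAddChar_apply, Circle.norm_coe, one_mul]
  have hP0 : (0 : ℝ) < (((p₁ * Q : ℕ+) : ℕ) : ℝ) := by exact_mod_cast PNat.pos _
  have hw0' : 0 < ∑ j, ‖w j‖ ^ 2 :=
    lt_of_le_of_ne (Finset.sum_nonneg fun j _ => by positivity) (Ne.symm hw0)
  have hG := norm_chirpWeight_sum_le p₁ Q hP h2 A W hW w hw (t + j₀)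
  calc ‖∑ j, (ZMod.stdAddChar (-((j + (t + j₀)) ^ 2)) : ℂ) * w j‖ ^ 2
          / ((((p₁ * Q : ℕ+) : ℕ) : ℝ) * ∑ j, ‖w j‖ ^ 2)
      ≤ (Real.sqrt ((p₁ * Q : ℕ+) : ℕ) * (2 + Real.log ((p₁ * Q : ℕ+) : ℕ))
            * intervalVariation p₁ Q w A W) ^ 2
          / ((((p₁ * Q : ℕ+) : ℕ) : ℝ) * ∑ j, ‖w j‖ ^ 2) := by
        gcongr
    _ = (2 + Real.log ((p₁ * Q : ℕ+) : ℕ)) ^ 2 * intervalVariation p₁ Q w A W ^ 2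
          / ∑ j, ‖w j‖ ^ 2 := by
        rw [mul_pow, mul_pow, Real.sq_sqrt hP0.le, mul_assoc,
          mul_div_mul_left _ _ (ne_of_gt hP0)]

end Line

end Literature.Computability.Cryptography.Chen2024

namespace Literature.Computability.Cryptography.Chen2024.Shape

open scoped BigOperators

variable (S : Shape)

/-- **Every admissible shape, any profile**: a non-zero line profile vanishing off a set `W` of line
positions gives every hyperplane value probability `≤ |W|/P`. [cite: ChenQuantumLattice2024, §3.5.9 pp. 35–38; folklore] -/
theorem prob_profile_le_card (h : S.Admissible) (c : ZP S.p₁ S.Q → ℂ) (hc0 : ∑ j, ‖c j‖ ^ 2 ≠ 0)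
    (W : Finset (ZP S.p₁ S.Q)) (hc : ∀ j, j ∉ W → c j = 0) (t : ZP S.p₁ S.Q) :
    (∑ u ∈ Finset.univ.filter (fun u : Fin (S.n + 1) → ZMod S.N => lineFun S.n S.D S.p₁ S.Q S.b u = t),
        weight (qft (profileKet S.n S.D S.p₁ S.Q S.b S.v' c)) u)
        / ∑ u, weight (qft (profileKet S.n S.D S.p₁ S.Q S.b S.v' c)) u
      ≤ (W.card : ℝ) / ((S.P : ℕ) : ℝ) :=
  Chen2024.prob_profile_le_card S.n S.D S.p₁ S.Q S.b S.v' h.odd_P h.b_head c hc0 W hc t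

/-- **T8 for every window weight and every admissible shape**: with the chirp of `|φ8.b⟩` seen through
ANY weight `w ≠ 0` supported on an interval of `W ≤ P` line positions, every hyperplane value
`⟨b, u mod P⟩ = t` of one run has probability `≤ ((2 + log P)/√P)·(V(w)·√W/‖w‖₂)`.
[cite: Korobov1992, Ch. I §2 Thm 2 and §3 Thm 3; ChenQuantumLattice2024, §3.5.9 pp. 35–38] -/
theorem prob_chirpWeight_le_sqrt (h : S.Admissible) (A W : ℕ) (hW : W ≤ (S.P : ℕ))
    (w : ZP S.p₁ S.Q → ℂ) (hw : ∀ j, j ∉ intervalWindow S.p₁ S.Q A W → w j = 0)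
    (hw0 : ∑ j, ‖w j‖ ^ 2 ≠ 0) (t : ZP S.p₁ S.Q) :
    (∑ u ∈ Finset.univ.filter (fun u : Fin (S.n + 1) → ZMod S.N => lineFun S.n S.D S.p₁ S.Q S.b u = t),
        weight (qft (profileKet S.n S.D S.p₁ S.Q S.b S.v' (chirpWeight S.p₁ S.Q w))) u)
        / ∑ u, weight (qft (profileKet S.n S.D S.p₁ S.Q S.b S.v' (chirpWeight S.p₁ S.Q w))) u
      ≤ (2 + Real.log (S.P : ℕ)) / Real.sqrt (S.P : ℕ)
          * (intervalVariation S.p₁ S.Q w A W * Real.sqrt W / Real.sqrt (∑ j, ‖w j‖ ^ 2)) :=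
  Chen2024.prob_chirpWeight_le_sqrt S.n S.D S.p₁ S.Q S.b S.v' h.odd_P h.two_le_P h.b_head A W hW w hw
    hw0 t

end Literature.Computability.Cryptography.Chen2024.Shape
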